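import Summits.QuantumFields.YangMills.Theorems.BalabanUVNodesK0AxCauchyDecouplingProduct

/-!
# K0⁷/K0ᴬ cover, FE cluster half — Cauchy–decoupling helper §4: DIFFERENCES OVER A FINITE SET OF PARAMETERS AND THE
# PRODUCT RULE OVER A FAMILY OF PAIRWISE DISJOINT BLOCKS (print [II] (2.10)–(2.11): «H(Z) = Π_i H(Z_i)» ⇒ polymer activities)

LANDING NOTE (porter ▶ PTC-1 g4, 2026-08-31; AUTHORSHIP = ◇ lens-1 g12 «cauchy-analytic», HOME sketch `nodeO-cover/LENS-1g12-CauchyDecouplingBlocks-v1.lean` sha16 b344679fbbb8c9cd · 188 l. · 1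
generic def (`decDiffSet`) + 13 thm · 0 sorry (CANDIDATE 14: the BLOCKS helper — order-free `Δ_S`, Cauchy bound `M·e^{−κ₁#S}`, and print [II] (2.10)–(2.11) «H(Z) = Π H(Z_i)» as
`decDiffSet_biUnion_prod` over pairwise disjoint blocks with block-local factors; companion of ✓p824330 ∕ ✓p824499 ∕ ✓p824868)): landed VERBATIM (only this paragraph added) under the basename ◇
proposed (`…Theorems/BalabanUVNodesK0AxCauchyDecouplingBlocks.lean`, same ns `…Theorems.K0AxCauchyDecoupling`) as INTENT-75; one import ✓p824868 `…K0AxCauchyDecouplingProduct`; `--supports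
stmt-QuantumFields-27930 --as helper` (NO `--workitem`; kind definition by the `def` rule); ◆ CRIT-1 g38's cut: «CUT CANDIDATE 14 → GO VERBATIM; 13 thm ∕ 1 def, every decl docstringed; axioms
standard on 7 guarded names (with a negative-control probe); J4: 13 × 0, `indepOf_finset_prod` only as a private decl over a different `IndepOf` elsewhere; J1′∕J5′: set-form of the landed list
algebra, order-freeness PROVED via ✓`decDiffList_perm`; SAME-WALL: SURVIVES as an S-size REPRESENTATION brick; B unchanged (N4-R the wall, N8b, N1′, N2b′, N7)» (nodeO STATUS 2026-08-31T14:13:46Z).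
HONEST (porter): model-free finite-set bookkeeping over `decDiffList`, kernel-checked — proves NOTHING of Bałaban (the N4-R ∕ N8b model letters untouched and OPEN); ⟨27930⟩ `stub_FE` ∕ `stub_P0C`
OPEN; K0ᴬ stmt-QuantumFields-27238 OPEN; NODE O 0∕1; COUNT 8∕28 · K 1∕4 UNMOVED; finite 𝕋⁴ at fixed ε — NOT continuum ∕ OS ∕ Clay; the Yang–Mills mass gap is NOT proved by any of this.

Lens-1 (ideator 1, g12) NODE v13.3 «cauchy-analytic», step (a) of the corrected FE-2 chain (HOME
`nodeO-cover/LENS-1-NODE-v13p3.md`).  MODEL-FREE bookkeeping on top of ✓`BalabanUVNodesK0AxCauchyDecouplingProduct`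
(✓p824868): the decoupled difference over a finite SET of parameters `decDiffSet S G := decDiffList S.toList G`
(order-independent by ✓`decDiffList_perm`), its one-element and union rules, and the ★ BLOCK PRODUCT RULE
`decDiffSet (⋃_{c ∈ 𝒞} blk c) (Π_{c ∈ 𝒞} G c) = Π_{c ∈ 𝒞} decDiffSet (blk c) (G c)` for pairwise disjoint blocks `blk c`
and block-local functionals `G c` (each `G c` ignores every parameter outside `blk c`).  This is the generic half of the
passage from the unrooted decoupling expansion (✓`decoupling_expansion`, l = all cubes of Z) to a hard-core gas of
CONNECTED polymers: once the MODEL supplies the factorisation of the normalised fluctuation factor at `t = 0 off l'`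
over the components `c ∈ rcomponents l'` (model letter N8b), this file turns `Δ_{l'}` of that product into
`Π_c Δ_c`, and ✓`Literature.Probability.LatticeModels.PolymerGasGeometric.sum_powerset_prod_rcomponents` regroups the
subset sum into `polymerPartitionFunction` — after which the Kotecký–Preiss layer of the tree
(✓`Literature.Probability.LatticeModels.ClusterExpansion.exp_polymerLogZ`, ✓`polymerLogZ_eq_sum_truncatedWeight`) takes the
logarithm (print (2.11)–(2.13)).

HONEST FRAMING.  Finite-set bookkeeping over `decDiffList`; NOTHING of [Balaban1988RG2Cluster] is asserted, ported or
discharged (the paper is cited as LOCATOR of the structure only); no model object of the record occurs; `stub_FE` ∕ `stub_P0C`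
of ⟨stmt-QuantumFields-27930⟩, K0⁷ ⟨20541⟩, K0ᴬ ⟨27238⟩ stay OPEN and nothing here proves any part of them; NODE O 0∕1; finite
𝕋⁴ at fixed ε — NOT continuum ∕ OS; **the Yang–Mills mass gap (Clay) is NOT proved by any of this.**  No `sorry`, no `instance`,
no `notation`; one `def` (`decDiffSet`); standard axioms.
-/

noncomputable section

open Function

namespace Summit.QuantumFields.YangMills.Theorems.K0AxCauchyDecoupling

variable {ι : Type*} [DecidableEq ι]

/-! ## §1  The decoupled difference over a finite set of parameters -/

/-- `Δ_S G`: the fully decoupled difference over a finite SET `S` of parameters (any enumeration; order-independent by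
✓`decDiffList_perm`). [cite: Balaban1988RG2Cluster, (2.8)–(2.9) p.13 «∂^X ∕ ∂s» (locator)] -/
def decDiffSet (S : Finset ι) (G : (ι → ℂ) → ℂ) : (ι → ℂ) → ℂ := decDiffList S.toList G

/-- Any duplicate-free enumeration of `S` computes `Δ_S`. -/
theorem decDiffSet_eq_decDiffList {S : Finset ι} {l : List ι} (hl : l.Nodup) (h : l.toFinset = S)
    (G : (ι → ℂ) → ℂ) : decDiffSet S G = decDiffList l G :=
  decDiffList_perm (List.perm_of_nodup_nodup_toFinset_eq (Finset.nodup_toList S) hl (by simp [h])) G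

/-- `Δ_∅ G = G`. -/
theorem decDiffSet_empty (G : (ι → ℂ) → ℂ) : decDiffSet ∅ G = G := by
  simp [decDiffSet]

/-- One-element rule: `Δ_{insert y S} G = Δ_y (Δ_S G)` for `y ∉ S`. -/
theorem decDiffSet_insert {y : ι} {S : Finset ι} (hy : y ∉ S) (G : (ι → ℂ) → ℂ) :
    decDiffSet (insert y S) G = decDiff y (decDiffSet S G) := by
  have hperm : (insert y S).toList.Perm (y :: S.toList) := by
    refine List.perm_of_nodup_nodup_toFinset_eq (Finset.nodup_toList _) ?_ ?_
    · exact List.nodup_cons.2 ⟨fun h => hy (Finset.mem_toList.1 h), Finset.nodup_toList S⟩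
    · simp
  unfold decDiffSet
  rw [decDiffList_perm hperm]
  rfl

/-- `Δ_{{y}} G = Δ_y G`. -/
theorem decDiffSet_singleton (y : ι) (G : (ι → ℂ) → ℂ) : decDiffSet {y} G = decDiff y G := by
  rw [← Finset.insert_empty, decDiffSet_insert (Finset.notMem_empty y), decDiffSet_empty]

/-- `Δ_S` preserves independence of a parameter outside `S`. -/
theorem indepOf_decDiffSet {y : ι} {S : Finset ι} {G : (ι → ℂ) → ℂ} (h : IndepOf y G) (hy : y ∉ S) :
    IndepOf y (decDiffSet S G) :=
  indepOf_decDiffList h fun h' => hy (Finset.mem_toList.1 h')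

/-- `Δ_S G = 0` identically as soon as `G` ignores one parameter of `S`. [cite: Balaban1988RG2Cluster, (1.9)–(1.10) p.4] -/
theorem decDiffSet_eq_zero_of_indepOf {y : ι} {S : Finset ι} {G : (ι → ℂ) → ℂ} (hy : y ∈ S) (h : IndepOf y G) :
    decDiffSet S G = 0 :=
  decDiffList_eq_zero_of_indepOf h (Finset.mem_toList.2 hy)

/-- The CAUCHY BOUND over a set (✓`norm_decDiffList_le` BY NAME): `‖(Δ_S F)(s)‖ ≤ M ∕ (R − 1)^{#S}` on the closed polydisc
of radius `R` for `F` separately holomorphic and bounded by `M` there. [cite: Balaban1988RG2Cluster, (2.21)–(2.22) p.16 (locator); Balaban1987RG1, (1.18) p.263 (shape)] -/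
theorem norm_decDiffSet_le {R M : ℝ} (hR : 1 < R) {F : (ι → ℂ) → ℂ} (hhol : SepHolOff R [] F)
    (hbdd : BddOnPoly R M F) (S : Finset ι) {s : ι → ℂ} (hs : s ∈ cpoly R) :
    ‖decDiffSet S F s‖ ≤ M / (R - 1) ^ S.card := by
  simpa [decDiffSet, Finset.length_toList] using norm_decDiffList_le hR hhol hbdd (Finset.nodup_toList S) hs

/-- (1.18) currency over a set: `‖(Δ_S F)(s)‖ ≤ M·e^{−κ₁ #S}` once `e^{κ₁} ≤ R − 1` (✓`norm_decDiffList_le_exp` BY NAME). -/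
theorem norm_decDiffSet_le_exp {R M κ₁ : ℝ} (hR : 1 < R) (hκ : Real.exp κ₁ ≤ R - 1) (hM : 0 ≤ M)
    {F : (ι → ℂ) → ℂ} (hhol : SepHolOff R [] F) (hbdd : BddOnPoly R M F) (S : Finset ι)
    {s : ι → ℂ} (hs : s ∈ cpoly R) :
    ‖decDiffSet S F s‖ ≤ M * Real.exp (-κ₁ * S.card) := by
  simpa [decDiffSet, Finset.length_toList] using norm_decDiffList_le_exp hR hκ hM hhol hbdd (Finset.nodup_toList S) hs

/-! ## §2  Product rules -/

/-- A product over a finite family of functionals each ignoring `y` ignores `y`. -/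
theorem indepOf_finset_prod {κ : Type*} {y : ι} (𝒞 : Finset κ) {G : κ → (ι → ℂ) → ℂ}
    (h : ∀ c ∈ 𝒞, IndepOf y (G c)) : IndepOf y (fun φ => ∏ c ∈ 𝒞, G c φ) := by
  classical
  revert h
  refine Finset.induction_on
    (motive := fun 𝒞 => (∀ c ∈ 𝒞, IndepOf y (G c)) → IndepOf y (fun φ => ∏ c ∈ 𝒞, G c φ)) 𝒞 ?_ ?_
  · intro _ s t
    simp
  · intro c 𝒞 hc ih h s t
    have h1 : G c (update s y t) = G c s := h c (Finset.mem_insert_self c 𝒞) s t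
    have h2 := ih (fun c' hc' => h c' (Finset.mem_insert_of_mem hc')) s t
    simp only at h2
    simp only [Finset.prod_insert hc, h1, h2]

/-- UNION RULE: for disjoint `S`, `T`, `G` ignoring the parameters of `T` and `H` those of `S`,
`Δ_{S ∪ T} (G·H) = (Δ_S G)·(Δ_T H)` (✓`decDiffList_append_mul` in set form).
[cite: Balaban1988RG2Cluster, (2.10) p.14 «H(Z) = Π H(Z_i)»] -/
theorem decDiffSet_union_mul {S T : Finset ι} {G H : (ι → ℂ) → ℂ} (hST : Disjoint S T)
    (hG : ∀ y ∈ T, IndepOf y G) (hH : ∀ y ∈ S, IndepOf y H) :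
    decDiffSet (S ∪ T) (G * H) = decDiffSet S G * decDiffSet T H := by
  revert hST hH
  refine Finset.induction_on
    (motive := fun S => Disjoint S T → (∀ y ∈ S, IndepOf y H) →
      decDiffSet (S ∪ T) (G * H) = decDiffSet S G * decDiffSet T H) S ?_ ?_
  · intro _ _
    rw [Finset.empty_union, decDiffSet_empty]
    exact decDiffList_mul_of_indepOf_left H fun y hy => hG y (Finset.mem_toList.1 hy)
  · intro y S hy ih hST hH
    have hyT : y ∉ T := fun h => Finset.disjoint_left.1 hST (Finset.mem_insert_self y S) h
    have hST' : Disjoint S T := Finset.disjoint_of_subset_left (Finset.subset_insert y S) hST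
    have hyST : y ∉ S ∪ T := by simp [hy, hyT]
    rw [Finset.insert_union, decDiffSet_insert hyST, ih hST' (fun y' hy' => hH y' (Finset.mem_insert_of_mem hy')),
      decDiff_mul_of_indepOf_right _ (indepOf_decDiffSet (hH y (Finset.mem_insert_self y S)) hyT),
      decDiffSet_insert hy]

/-- ★★ **BLOCK PRODUCT RULE** — print's (2.10)–(2.11): for a finite family `𝒞` of pairwise DISJOINT parameter blocks `blk c`
and functionals `G c` each ignoring every parameter outside its block,
`Δ_{⋃_{c∈𝒞} blk c} (Π_{c∈𝒞} G c) = Π_{c∈𝒞} Δ_{blk c} (G c)`.  With `𝒞 = rcomponents l'` of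
✓`Literature.Probability.LatticeModels.PolymerGasGeometric` this is the factorisation of the `l'`-term of the unrooted
decoupling expansion into connected-polymer activities. [cite: Balaban1988RG2Cluster, (2.10)–(2.11) p.14 «H(Z) = Π_i H(Z_i) … exp of the sum over polymers»] -/
theorem decDiffSet_biUnion_prod {κ : Type*} [DecidableEq κ] (blk : κ → Finset ι) (G : κ → (ι → ℂ) → ℂ)
    (𝒞 : Finset κ) (hdisj : ∀ c ∈ 𝒞, ∀ c' ∈ 𝒞, c ≠ c' → Disjoint (blk c) (blk c'))
    (hloc : ∀ c ∈ 𝒞, ∀ y, y ∉ blk c → IndepOf y (G c)) :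
    decDiffSet (𝒞.biUnion blk) (fun φ => ∏ c ∈ 𝒞, G c φ) = fun ψ => ∏ c ∈ 𝒞, decDiffSet (blk c) (G c) ψ := by
  revert hdisj hloc
  refine Finset.induction_on
    (motive := fun 𝒞 => (∀ c ∈ 𝒞, ∀ c' ∈ 𝒞, c ≠ c' → Disjoint (blk c) (blk c')) →
      (∀ c ∈ 𝒞, ∀ y, y ∉ blk c → IndepOf y (G c)) →
      decDiffSet (𝒞.biUnion blk) (fun φ => ∏ c ∈ 𝒞, G c φ) = fun ψ => ∏ c ∈ 𝒞, decDiffSet (blk c) (G c) ψ) 𝒞 ?_ ?_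
  · intro _ _
    funext ψ
    simp [decDiffSet_empty]
  · intro c 𝒞 hc ih hdisj hloc
    have hdisj' : ∀ c₁ ∈ 𝒞, ∀ c₂ ∈ 𝒞, c₁ ≠ c₂ → Disjoint (blk c₁) (blk c₂) :=
      fun c₁ h₁ c₂ h₂ hne => hdisj c₁ (Finset.mem_insert_of_mem h₁) c₂ (Finset.mem_insert_of_mem h₂) hne
    have hloc' : ∀ c' ∈ 𝒞, ∀ y, y ∉ blk c' → IndepOf y (G c') :=
      fun c' h' => hloc c' (Finset.mem_insert_of_mem h')
    have hcT : Disjoint (blk c) (𝒞.biUnion blk) := by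
      rw [Finset.disjoint_biUnion_right]
      intro c' hc'
      exact hdisj c (Finset.mem_insert_self c 𝒞) c' (Finset.mem_insert_of_mem hc') (fun e => hc (e ▸ hc'))
    have hG : ∀ y ∈ 𝒞.biUnion blk, IndepOf y (G c) := by
      intro y hy
      refine hloc c (Finset.mem_insert_self c 𝒞) y fun hyc => ?_
      exact Finset.disjoint_left.1 hcT hyc hy
    have hH : ∀ y ∈ blk c, IndepOf y (fun φ => ∏ c' ∈ 𝒞, G c' φ) := by
      intro y hyc
      refine indepOf_finset_prod 𝒞 fun c' hc' => hloc' c' hc' y fun hyc' => ?_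
      exact Finset.disjoint_left.1 hcT hyc (Finset.mem_biUnion.2 ⟨c', hc', hyc'⟩)
    have hsplit : (fun φ => ∏ c' ∈ insert c 𝒞, G c' φ) = G c * fun φ => ∏ c' ∈ 𝒞, G c' φ := by
      funext φ
      simp [Finset.prod_insert hc]
    rw [Finset.biUnion_insert, hsplit, decDiffSet_union_mul hcT hG hH, ih hdisj' hloc']
    funext ψ
    simp [Finset.prod_insert hc]

/-- The block product rule with the blocks a finite family `𝒳` of pairwise disjoint finite sets (`blk = id`; e.g.
`𝒳 = rcomponents R Q` of ✓`PolymerGasGeometric`, pairwise disjoint by ✓`isCompatible_rcomponents`). -/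
theorem decDiffSet_biUnion_id_prod (𝒳 : Finset (Finset ι)) (G : Finset ι → (ι → ℂ) → ℂ)
    (hdisj : ∀ X ∈ 𝒳, ∀ X' ∈ 𝒳, X ≠ X' → Disjoint X X')
    (hloc : ∀ X ∈ 𝒳, ∀ y, y ∉ X → IndepOf y (G X)) :
    decDiffSet (𝒳.biUnion id) (fun φ => ∏ X ∈ 𝒳, G X φ) = fun ψ => ∏ X ∈ 𝒳, decDiffSet X (G X) ψ :=
  decDiffSet_biUnion_prod id G 𝒳 hdisj hloc

/-- VANISHING OF A BLOCK TERM: if some block `blk c`, `c ∈ 𝒞`, contains a parameter its own functional ignores, the whole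
`Δ`-product vanishes — e.g. a SINGLETON component whose normalised factor is constant (the singleton-free rule (R-e) of
✓`BalabanUVNodesK0RecordFormatNamesFluctRatioC.recordSWeight`): such `l'` contribute nothing to the expansion. -/
theorem prod_decDiffSet_eq_zero_of_indepOf {κ : Type*} (blk : κ → Finset ι) (G : κ → (ι → ℂ) → ℂ) (𝒞 : Finset κ)
    {c : κ} (hc : c ∈ 𝒞) {y : ι} (hy : y ∈ blk c) (h : IndepOf y (G c)) (ψ : ι → ℂ) :
    ∏ c' ∈ 𝒞, decDiffSet (blk c') (G c') ψ = 0 := by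
  classical
  exact Finset.prod_eq_zero hc (by rw [decDiffSet_eq_zero_of_indepOf hy h]; rfl)

end Summit.QuantumFields.YangMills.Theorems.K0AxCauchyDecoupling

end
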